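import Summits.BirchSwinnertonDyer.BirchSwinnertonDyer.Theorems.AlignedTransportAtTwoMainConjectureOfRankZeroBSDAtTwoFineRoadRealKummerWitnessPrelim
import Literature.NumberTheory.EllipticCurves.FourTorsionHalvingProofs
import Mathlib.Analysis.Complex.Basic
import HarnessLib

/-!
# Translation by a `2`-torsion point on any model: `4 (x(P + T) − e)(x(P) − e) = u′(e)`, and its archimedean consequence —
# a `2`-torsion point `T` with `u′(x(T)) < 0` under a real embedding is NOT of the form `τ P − P` (`τ` the complex conjugation)

Cell `bsd-f1-sign2`, WIDTH-5 attach seat `bsd-line-att-p5` (gen 8) on line `birth` of crux C2 stmt-BirchSwinnertonDyer-22298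
`MainConjectureOfRankZeroBSDAtTwo` (route `AlignedTransportAtTwo`); sequel of `…FineRoadRealKummerWitness` (att-p5 g8), toolkit for
the `E[2^∞]`-level form of the `Δ > 0` Kummer witness (`…FineRoadRealKummerWitnessPrimary`). A `--supports 22298 --as helper` file.
HONEST FRAMING: THEOREMS ONLY — no definition, no named fact, no `sorry`; C2-NEUTRAL; BSD is NOT proved by any of this.

* §1 **`four_mul_xco_add_sub_mul`** — on an ARBITRARY Weierstrass model over any field with `2 ≠ 0` (in fact any field): if
  `T ≠ O`, `T + T = O`, `P ≠ O` and `x(P) ≠ x(T) =: e`, then `4 (x(P + T) − e) (x(P) − e) = u′(e)` with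
  `u′(e) = 12e² + 2b₂e + 2b₄` (tree `uq`; at `e = eᵢ` it is `4(eᵢ − eⱼ)(eᵢ − e_k)`, tree `uT_eq`) —
  the classical `x(P + Tᵢ) − eᵢ = (eᵢ − eⱼ)(eᵢ − e_k)/(x(P) − eᵢ)` (Silverman, *AEC*, proof of X.1.4) in model-free form, from
  Mathlib's chord formula (`Affine.Point.add_of_X_ne`, `slope_of_X_ne`, `addX`) and `ψ₂²(e) = 0` through the identity
  `4(y−t)² + 4a₁(y−t)(x−e) − 4(a₂+x+2e)(x−e)² − u′(e)(x−e) = (Y² − ψ₂²(x)) + ψ₂²(e) + S(S − 2Y)`, `Y = 2y + a₁x + a₃`,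
  `S = 2t + a₁e + a₃ (= 0)`; companion of the tree's halving identity `4(x(Q) − e)² = u′(e)` (`four_mul_sq_xco_sub_eq`).
* §2 **`not_exists_smul_eq_add_of_re_lt_zero`** — if `τ ∈ Γ_K` acts as complex conjugation under `ι : K̄ → ℂ`, `τ T = T` and
  `ι u′(x(T)) < 0`, then there is NO `P ∈ E(K̄)` with `τ P = P + T`: for such `P`, `u = x(P) − e` would satisfy
  `4 ū u = u′(e)`, i.e. `4|ι u|² = ι u′(e) < 0`. So `T` represents a NON-ZERO class of `H¹(Gal(ℂ/ℝ), E(ℂ))` (the real period class;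
  for `E/ℚ` with `Δ_E > 0` and `T = T_{middle}` this is `H¹(ℝ, E) ≠ 0`), a fortiori of `H¹(ℝ, E[2^∞])`;
  `not_exists_smul_eq_add_T` — the same for the letter `Tᵢ` with `ι αᵢ < 0`, `αᵢ = (eᵢ − eᵢ₊₁)(eᵢ − eᵢ₊₂)`.
* §3 `not_lt_zero_and_lt_zero` — for three distinct reals at most ONE of the products `(rᵢ − rᵢ₊₁)(rᵢ − rᵢ₊₂)` is negative
  (with `RealKummerWitnessPrelim.three_reals_sign`: exactly one).

References: J. H. Silverman, *AEC* III.2.3 (chord formula), Ex. III.3.7, X.1 (proof of Prop. 1.4); J. S. Milne, *ADT* I §3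
(Rem. 3.7: `H¹(ℝ, E) ≅ E(ℝ)/E(ℝ)⁰`); B. H. Gross, *Kolyvagin's work on modular elliptic curves* (1991) §1 (real components).
-/

set_option autoImplicit false
-- the Theorems namespace of this sub repeats the summit name by design (D-0017 nested layout)
set_option linter.dupNamespace false

noncomputable section

open scoped Classical

namespace Summit.BirchSwinnertonDyer.BirchSwinnertonDyer.Theorems.AlignedTransportAtTwoFineRoad.RealKummerTranslation

open WeierstrassCurve Field Literature.NumberTheory.EllipticCurves Literature.NumberTheory.GaloisRepresentations
  Literature.NumberTheory.EllipticCurves.DokchitserDokchitser2012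
  Summit.BirchSwinnertonDyer.BirchSwinnertonDyer.Theorems.AlignedTransportAtTwoFineRoad

universe u

/-! ## §1 The translation identity on an arbitrary model -/

section Translation

variable {K : Type u} [Field K] (W : WeierstrassCurve K)

/-- **The translation identity.** If `T ≠ O`, `T + T = O`, `P ≠ O` and `x(P) ≠ x(T)`, then
`4 (x(P + T) − x(T)) (x(P) − x(T)) = u′(x(T))`, `u′(e) = 12e² + 2b₂e + 2b₄` — the chord formula
`x(P + T) = λ² + a₁λ − a₂ − x(P) − x(T)`, `λ = (y_P − y_T)/(x(P) − x(T))` (Silverman, *AEC*, III.2.3), combined with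
`ψ₂²(x(T)) = 0` and `2y_T + a₁x(T) + a₃ = 0`. [cite: SilvermanAEC2009, III.2.3 (group law algorithm)]
[cite: SilvermanAEC2009, X.1 (proof of Prop. 1.4)] -/
theorem four_mul_xco_add_sub_mul {P T : geomPoints W} (hT0 : T ≠ 0) (hT : T + T = 0) (hP0 : P ≠ 0)
    (hx : xco W P ≠ xco W T) :
    4 * (xco W (P + T) - xco W T) * (xco W P - xco W T) = uq W (xco W T) := by
  have hroot := isRoot_xco_of_add_self_eq_zero W hT0 hT
  set W' := W.baseChange (AlgebraicClosure K) with hW'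
  change W'.toAffine.Point at P T
  rcases T with _ | ⟨e, t, hTns⟩
  · exact absurd rfl hT0
  rcases P with _ | ⟨x, y, h⟩
  · exact absurd rfl hP0
  change x ≠ e at hx
  have hneg : -(Affine.Point.some e t hTns : W'.toAffine.Point) = Affine.Point.some e t hTns := by
    rw [neg_eq_iff_add_eq_zero]; exact hT
  rw [Affine.Point.neg_some, Affine.Point.some.injEq] at hneg
  obtain ⟨-, ht⟩ := hneg
  rw [Affine.negY] at ht
  have hx3 : xco W ((Affine.Point.some x y h : W'.toAffine.Point) + Affine.Point.some e t hTns) =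
      W'.toAffine.addX x e (W'.toAffine.slope x e y t) := by
    rw [Affine.Point.add_of_X_ne hx]; rfl
  change 4 * (xco W ((Affine.Point.some x y h : W'.toAffine.Point) + Affine.Point.some e t hTns) - e) * (x - e) =
    uq W e
  rw [hx3, Affine.addX, Affine.slope_of_X_ne hx]
  have hxe : x - e ≠ 0 := sub_ne_zero.2 hx
  obtain ⟨ℓ, hℓdef⟩ : ∃ ℓ, (y - t) / (x - e) = ℓ := ⟨_, rfl⟩
  rw [hℓdef]
  have hℓ : ℓ * (x - e) = y - t := by rw [← hℓdef, div_mul_cancel₀ _ hxe]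
  have hcurve : y ^ 2 + W'.a₁ * x * y + W'.a₃ * y = x ^ 3 + W'.a₂ * x ^ 2 + W'.a₄ * x + W'.a₆ :=
    (Affine.equation_iff _ _).mp h.left
  have hr : 4 * e ^ 3 + W'.b₂ * e ^ 2 + 2 * W'.b₄ * e + W'.b₆ = 0 := by
    have h' := hroot
    simp only [xco, twoTorsionPolynomial, Cubic.toPoly, Polynomial.IsRoot.def, Polynomial.eval_add,
      Polynomial.eval_mul, Polynomial.eval_C, Polynomial.eval_pow, Polynomial.eval_X] at h'
    linear_combination h'
  have hS : 2 * t + W'.a₁ * e + W'.a₃ = 0 := by linear_combination -ht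
  have hS2 : (2 * t + W'.a₁ * e + W'.a₃) * ((2 * t + W'.a₁ * e + W'.a₃) - 2 * (2 * y + W'.a₁ * x + W'.a₃)) = 0 := by
    rw [hS, zero_mul]
  apply mul_right_cancel₀ hxe
  simp only [uq, ← hW', WeierstrassCurve.b₂, WeierstrassCurve.b₄, WeierstrassCurve.b₆] at hr ⊢
  linear_combination (4 * (ℓ * (x - e) + y - t) + 4 * W'.a₁ * (x - e)) * hℓ + 4 * hcurve + hr + hS2

end Translation

/-! ## §2 A `2`-torsion point negative under a real embedding is not a `τ`-coboundary of `E(K̄)` -/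

section Real

variable {K : Type u} [Field K] (W : WeierstrassCurve K)

/-- **`T` is not of the form `τ P − P`.** Let `τ ∈ Γ_K` act as complex conjugation under `ι : K̄ → ℂ` (`ι (τ z) = conj (ι z)`),
and let `T ∈ E(K̄)`, `T ≠ O`, `2T = O`, `τ T = T`, with `ι u′(x(T)) < 0` (a real number since `τ` fixes `x(T)`). Then no
`P ∈ E(K̄)` satisfies `τ P = P + T`: otherwise `P ≠ O`, `x(P) ≠ x(T)` (else `P = T`, `τ T = O`), and the translation identity
reads `4 ū u = ι u′(x(T))` for `u = ι(x(P) − x(T))`, a contradiction of signs. Equivalently: the cocycle `τ ↦ T` is a NON-ZERO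
class of `H¹(⟨τ⟩, E(K̄))` (the class of the real components, Milne *ADT* I Rem. 3.7). [cite: MilneADT2006, Ch. I §3 (Rem. 3.7)]
[cite: SilvermanAEC2009, X.1 (proof of Prop. 1.4)] -/
theorem not_exists_smul_eq_add_of_re_lt_zero {τ : absoluteGaloisGroup K} (ι : AlgebraicClosure K →+* ℂ)
    (hι : ∀ z : AlgebraicClosure K, ι (τ • z) = starRingEnd ℂ (ι z)) {T : geomPoints W} (hT0 : T ≠ 0) (hT : T + T = 0)
    (hτT : τ • T = T) (hneg : (ι (uq W (xco W T))).re < 0) :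
    ¬ ∃ P : geomPoints W, τ • P = P + T := by
  rintro ⟨P, hP⟩
  have hP0 : P ≠ 0 := by
    rintro rfl
    rw [smul_zero, zero_add] at hP
    exact hT0 hP.symm
  have hx : xco W P ≠ xco W T := by
    intro hx
    have hPT : P = T := eq_of_xco_eq W hP0 hT0 hT hx
    rw [hPT, hτT] at hP
    exact hT0 (by simpa using hP)
  have hid := four_mul_xco_add_sub_mul W hT0 hT hP0 hx
  have hτe : τ • xco W T = xco W T := by rw [← xco_smul, hτT]
  have hxadd : xco W (P + T) = τ • xco W P := by rw [← hP, xco_smul]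
  -- apply `ι`: `4 conj(u) u = ι u′(e)` with `u = ι (x(P) − e)`
  set u : ℂ := ι (xco W P - xco W T) with hu
  have hconj : ι (xco W (P + T) - xco W T) = starRingEnd ℂ u := by
    rw [hxadd, hu, ← hι, smul_sub, hτe]
  have key : ι (uq W (xco W T)) = 4 * (starRingEnd ℂ u * u) := by
    rw [← hid, map_mul, map_mul, hconj, map_ofNat, mul_assoc]
  have hre : (ι (uq W (xco W T))).re = 4 * Complex.normSq u := by
    rw [key, ← Complex.normSq_eq_conj_mul_self]
    simp
  have h0 : 0 ≤ Complex.normSq u := Complex.normSq_nonneg u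
  linarith

end Real

section Letters

variable {K : Type} [Field K] (W : WeierstrassCurve K) [W.IsElliptic] (h2 : (2 : K) ≠ 0)

/-- **The letter `Tᵢ` with `ι αᵢ < 0` is not of the form `τ P − P`** (`αᵢ = (eᵢ − eᵢ₊₁)(eᵢ − eᵢ₊₂)`, `u′(eᵢ) = 4αᵢ` by the tree's
`uT_eq`), for `τ ∈ ker ρ̄_{E,2}` a complex conjugation under `ι`. [cite: MilneADT2006, Ch. I §3 (Rem. 3.7)]
[cite: SilvermanAEC2009, X.1 (proof of Prop. 1.4)] -/
theorem not_exists_smul_eq_add_T {τ : absoluteGaloisGroup K} (hτ : τ ∈ (W.galoisRepTorsion 2).ker)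
    (ι : AlgebraicClosure K →+* ℂ) (hι : ∀ z : AlgebraicClosure K, ι (τ • z) = starRingEnd ℂ (ι z)) (i : Fin 3)
    (hneg : (ι ((xT W h2 i - xT W h2 (i + 1)) * (xT W h2 i - xT W h2 (i + 2)))).re < 0) :
    ¬ ∃ P : geomPoints W, τ • P = P + (T W h2 i : geomPoints W) := by
  have hτT : τ • (T W h2 i : geomPoints W) = (T W h2 i : geomPoints W) := by
    rw [← coe_T_permGal, RealKummerWitnessPrelim.permGal_eq_one_of_mem_ker W h2 hτ, Equiv.Perm.one_apply]
  -- `u′(eᵢ) = 4 αᵢ`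
  have huT : uq W (xco W (T W h2 i : geomPoints W)) = 4 * ((xT W h2 i - xT W h2 (i + 1)) * (xT W h2 i - xT W h2 (i + 2))) := by
    obtain ⟨h0, h1, h2'⟩ := uT_eq W h2
    have e01 : ((0 : Fin 3) + 1) = 1 := by decide
    have e02 : ((0 : Fin 3) + 2) = 2 := by decide
    have e11 : ((1 : Fin 3) + 1) = 2 := by decide
    have e12 : ((1 : Fin 3) + 2) = 0 := by decide
    have e21 : ((2 : Fin 3) + 1) = 0 := by decide
    have e22 : ((2 : Fin 3) + 2) = 1 := by decide
    change uT W h2 i = _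
    fin_cases i
    · simp only [Fin.zero_eta, Fin.isValue, e01, e02]
      exact h0
    · simp only [Fin.mk_one, Fin.isValue, e11, e12]
      rw [h1]; ring
    · simp only [Fin.reduceFinMk, Fin.isValue, e21, e22]
      exact h2'
  refine not_exists_smul_eq_add_of_re_lt_zero W ι hι (coe_T_ne_zero W h2 i) (coe_add_self_eq_zero W _) hτT ?_
  set z : ℂ := ι ((xT W h2 i - xT W h2 (i + 1)) * (xT W h2 i - xT W h2 (i + 2))) with hz
  rw [huT, map_mul, map_ofNat, Complex.mul_re]
  have h4re : (4 : ℂ).re = 4 := by norm_num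
  have h4im : (4 : ℂ).im = 0 := by norm_num
  rw [h4re, h4im, zero_mul, sub_zero]
  linarith

end Letters

/-! ## §3 Three distinct reals: at most one of the products `(rᵢ − rᵢ₊₁)(rᵢ − rᵢ₊₂)` is negative -/

/-- For three distinct reals, two of the products `(rᵢ − rᵢ₊₁)(rᵢ − rᵢ₊₂)` cannot both be negative (`rᵢ` and `rⱼ` cannot both lie
strictly between the other two). With `RealKummerWitnessPrelim.three_reals_sign`: exactly one is negative. [folklore] -/
theorem not_lt_zero_and_lt_zero (r₀ r₁ r₂ : ℝ) :
    ¬ ((r₀ - r₁) * (r₀ - r₂) < 0 ∧ (r₁ - r₂) * (r₁ - r₀) < 0) := by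
  rintro ⟨h0, h1⟩
  rcases mul_neg_iff.mp h0 with ⟨ha, hb⟩ | ⟨ha, hb⟩ <;> rcases mul_neg_iff.mp h1 with ⟨hc, hd⟩ | ⟨hc, hd⟩ <;> linarith

end Summit.BirchSwinnertonDyer.BirchSwinnertonDyer.Theorems.AlignedTransportAtTwoFineRoad.RealKummerTranslation

end
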